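import Summits.ABC.StewartYu.PadicG3SchedInst
import HarnessLib

/-!
# Cell abc-stewartyu, crux `Y07Odd` (stmt-ABC-19658), line `gen3-slab-odd`: the print box side `⌊Lbox/(2Aⱼ)⌋` (route-holder ruling R21-d,
# 2026-08-27T04:32Z: `sideS = ⌊Lbox/(4Aⱼ)⌋` halves every side and loses 2ⁿ in the Siegel count) — `sideS₂`, `UcardS₂`, and the END sizing
# re-proved with `2 ≤ Nq` (R21-b: `Nq = K ≥ 2`)

`Summits/ABC/StewartYu/PadicG3SchedS2.lean` — cell `abc-stewartyu` (seat p2-g4, F-odd lead).  Definitions `sideS₂`, `UcardS₂` and theorems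
`card_unk_le_UcardS₂`, `two_mul_Lb_sideS₂_le` (`2·Lb side₂ Sd j ≤ ⌊Nq·Lbox/(2^Sd Aⱼ)⌋ + 1` for `Nq ≥ 2`), `endSizingV₂`, `endSizing1₂`.  No named fact.

References: Yu. V. Nesterenko, LNM 1819 (2003) §3.4, §5.
-/

noncomputable section

open Finset
open Literature.NumberTheory.Transcendental

namespace Summit.ABC.StewartYu

namespace G3Setup

variable {p : ℕ} [Fact p.Prime] (S : G3Setup p) (Sc : G3Sched S.n) (P : PadicG3Par S.n)

/-- Print box half-sides `⌊Lbox/(2Aⱼ)⌋`. [cite: Nesterenko2003, §3.4] -/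
def sideS₂ (j : Fin S.n) : ℕ := ⌊Sc.Lbox / (2 * Sc.A j)⌋₊

/-- `#unk L₀ 𝔏 ≤ (L₀+1)·∏(2 side₂ⱼ + 1)`. [folklore] -/
def UcardS₂ : ℕ := (Sc.L₀ + 1) * ∏ j, (2 * S.sideS₂ Sc j + 1)

/-- The bound. [folklore] -/
theorem card_unk_le_UcardS₂ {𝔏 : Finset (Fin S.n → ℤ)} (h𝔏 : 𝔏 ⊆ S.box (S.sideS₂ Sc)) : (S.unk Sc.L₀ 𝔏).card ≤ S.UcardS₂ Sc := by
  unfold UcardS₂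
  rw [S.card_unk, ← S.card_box]
  exact Nat.mul_le_mul_left _ (card_le_card h𝔏)

/-- `2·Lb side₂ Sd j ≤ ⌊Nq·Lbox/(2^Sd Aⱼ)⌋ + 1` for `Nq ≥ 2`. [cite: Nesterenko2003, §5.2; shape only] -/
theorem two_mul_Lb_sideS₂_le {Nq : ℕ} (hNq : 2 ≤ Nq) (hL : 0 ≤ Sc.Lbox) (j : Fin S.n) :
    2 * S.Lb (S.sideS₂ Sc) Sc.Sd j ≤ ⌊(Nq : ℝ) * Sc.Lbox / (2 ^ Sc.Sd * Sc.A j)⌋₊ + 1 := by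
  have hA := Sc.hA j
  have hside : (S.sideS₂ Sc j : ℝ) ≤ Sc.Lbox / (2 * Sc.A j) := by unfold sideS₂; exact Nat.floor_le (by positivity)
  have hLb := S.Lb_le_real (S.sideS₂ Sc) Sc.Sd j
  have hreal : (2 * S.Lb (S.sideS₂ Sc) Sc.Sd j : ℝ) ≤ (Nq : ℝ) * Sc.Lbox / ((2 : ℝ) ^ Sc.Sd * Sc.A j) := by
    have hNq' : (2 : ℝ) ≤ Nq := by exact_mod_cast hNq
    calc (2 * S.Lb (S.sideS₂ Sc) Sc.Sd j : ℝ) ≤ 2 * (2 * (S.sideS₂ Sc j : ℝ) / (2 : ℝ) ^ Sc.Sd) := by linarith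
      _ ≤ 2 * (2 * (Sc.Lbox / (2 * Sc.A j)) / (2 : ℝ) ^ Sc.Sd) := by gcongr
      _ = 2 * Sc.Lbox / ((2 : ℝ) ^ Sc.Sd * Sc.A j) := by field_simp
      _ ≤ (Nq : ℝ) * Sc.Lbox / ((2 : ℝ) ^ Sc.Sd * Sc.A j) := by gcongr
  have : 2 * S.Lb (S.sideS₂ Sc) Sc.Sd j ≤ ⌊(Nq : ℝ) * Sc.Lbox / (2 ^ Sc.Sd * Sc.A j)⌋₊ := Nat.le_floor (by exact_mod_cast hreal)
  omega

/-- **END sizing of the `m = 0` branch**, print box, `Nq ≥ 2`. [cite: Nesterenko2003, §5; shape only] -/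
theorem endSizingV₂ (hNq : 2 ≤ P.Nq) : 2 * ((S.n + 1) * S.XfinOS P.schedV) ≤ S.NS P.schedV P.schedV.Sd S.n ∧
    (S.n + 1) * P.S0NV < S.TordS P.schedV P.schedV.Sd S.n ∧ P.schedV.L₀ ≤ P.D0V ∧
    ∀ j, 2 * S.Lb (S.sideS₂ P.schedV) P.schedV.Sd j ≤ P.DV j := by
  obtain ⟨h1, h2, h3, _⟩ := S.endSizingV P
  refine ⟨h1, h2, h3, fun j => ?_⟩
  have h := S.two_mul_Lb_sideS₂_le P.schedV hNq (by show (0 : ℝ) ≤ (P.LV : ℝ); positivity) j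
  unfold PadicG3Par.DV
  exact h

/-- **END sizing of the `m ≥ 1` branch**, print box, `Nq ≥ 2`. [cite: Nesterenko2003, §5; shape only] -/
theorem endSizing1₂ (hNq : 2 ≤ P.Nq) : 2 * ((S.n + 1) * S.XfinOS P.sched1) ≤ S.NS P.sched1 P.sched1.Sd S.n ∧
    (S.n + 1) * P.S₀N < S.TordS P.sched1 P.sched1.Sd S.n ∧ P.sched1.L₀ ≤ P.D₀ ∧
    ∀ j, 2 * S.Lb (S.sideS₂ P.sched1) P.sched1.Sd j ≤ P.D j := by
  obtain ⟨h1, h2, h3, _⟩ := S.endSizing1 P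
  refine ⟨h1, h2, h3, fun j => ?_⟩
  have h := S.two_mul_Lb_sideS₂_le P.sched1 hNq (by show (0 : ℝ) ≤ (P.L : ℝ); positivity) j
  unfold PadicG3Par.D
  exact h

end G3Setup

end Summit.ABC.StewartYu

end
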